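import Summits.CriticalPhenomena.PercolationContinuityZ3.Theses.PercFiniteBoxLRO
import Summits.CriticalPhenomena.PercolationContinuityZ3.Theorems.PercFiniteBoxLRORenormaliseFromLinearLROSamePCriterion
import Literature.Probability.Percolation.CriticalContinuityProofs

/-!
# Crux `PercFiniteBoxLRO.RenormaliseFromLinearLRO` (stmt-CriticalPhenomena-0857), line `registered` —
# no good boxes at criticality (registered sub-goal `stub_noGoodBoxAtPc`)

An UNCONDITIONAL consequence of the landed same-`p` criterion (`stub_sameP_criterion`, p151477): with its
`δ > 0`, for every `n ≥ 1` the good-box event `G_n` of `B(n) = [-n,n]³` (open crossing cluster + in-box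
uniqueness of the clusters of coordinate spread `≥ n`) has `P_{p_c}(G_n) ≤ 1 − δ` at `p_c = p_c(ℤ³)`.
Proof: `p_c > 0` (`criticalProb_zd_pos`); if `P_{p_c}(G_n) > 1 − δ` then, `q ↦ P_q(G_n)` being continuous
(`continuous_real_goodBox`, a polynomial in `q`), some `q < p_c` still has `P_q(G_n) > 1 − δ`, so the
criterion at the SAME `q` gives `θ(q) > 0`, contradicting `θ ≡ 0` below `p_c`
(`theta_eq_zero_of_lt_criticalProb_holds`).  This is the engine of the line's composition: the remaining
open stub `stub_critBoost` (linear-scale finite-box LRO at `p_c` ⇒ a `(1−δ')`-likely good box for every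
`δ'`) therefore amounts to refuting its own hypothesis, i.e. to `¬LRO_lin(p_c)`, which is the crux.

Lands `--supports stmt-CriticalPhenomena-0857` (registered sub-goal `stub_noGoodBoxAtPc`).
-/

noncomputable section

namespace Summit.CriticalPhenomena.PercolationContinuityZ3.Theorems.RenormaliseFromLinearLRO

open Literature.Probability.Percolation Literature.Probability.LatticeModels
open MeasureTheory

/-- The downward step, purely topological: in `[0,1]`, if `p ≠ 0` and a continuous `f` has `c < f p`,
then `c < f q` for some `q < p` (order topology + density of `[0,1]`). -/
theorem exists_lt_of_continuous_unitInterval {f : unitInterval → ℝ} (hf : Continuous f) {c : ℝ}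
    {p : unitInterval} (hp : (0 : unitInterval) < p) (hc : c < f p) :
    ∃ q : unitInterval, q < p ∧ c < f q := by
  have hU : IsOpen {b : unitInterval | c < f b} := isOpen_lt continuous_const hf
  obtain ⟨l, hl, hsub⟩ := exists_Ioc_subset_of_mem_nhds (hU.mem_nhds hc) ⟨0, hp⟩
  obtain ⟨q, hlq, hqp⟩ := exists_between hl
  exact ⟨q, hqp, hsub ⟨hlq, hqp.le⟩⟩

/-- **No good boxes at criticality, over the named event**: with the `δ` of the same-`p` criterion,
`P_{p_c}(goodBox n) ≤ 1 − δ` for every `n ≥ 1`. -/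
theorem real_goodBox_criticalProbI_le :
    ∃ δ : ℝ, 0 < δ ∧ ∀ n : ℕ, 1 ≤ n →
      (bondPercolation (zdGraph 3) (criticalProbI 3)).real (goodBox n) ≤ 1 - δ := by
  obtain ⟨δ, hδ, hcrit⟩ := sameP_criterion_goodBox
  refine ⟨δ, hδ, fun n hn => ?_⟩
  by_contra hgt
  have hgood : 1 - δ < (bondPercolation (zdGraph 3) (criticalProbI 3)).real (goodBox n) := not_le.1 hgt
  have h0lt : (0 : unitInterval) < criticalProbI 3 := by
    show (0 : ℝ) < criticalProb (zdGraph 3) (0 : Site 3)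
    exact criticalProb_zd_pos 3 (by norm_num)
  obtain ⟨q, hqp, hq⟩ := exists_lt_of_continuous_unitInterval (continuous_real_goodBox n) h0lt hgood
  have hθq : 0 < theta (zdGraph 3) 0 q := hcrit q n hn hq
  have hq0 : theta (zdGraph 3) (0 : Site 3) q = 0 :=
    theta_eq_zero_of_lt_criticalProb_holds (zdGraph 3) (0 : Site 3) q hqp
  exact absurd hq0 (ne_of_gt hθq)

/-- **Registered sub-goal `stub_noGoodBoxAtPc` of crux stmt-CriticalPhenomena-0857 (line `registered`):
no good boxes at criticality, event spelled out** — there is `δ > 0` such that for every `n ≥ 1`,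
`P_{p_c(ℤ³)}(G_n) ≤ 1 − δ`.  Unconditional (same-`p` criterion + continuity of the box polynomial +
`θ ≡ 0` below `p_c`).  Definitionally `real_goodBox_criticalProbI_le`. -/
theorem stub_noGoodBoxAtPc :
    ∃ δ : ℝ, 0 < δ ∧ ∀ n : ℕ, 1 ≤ n →
      (bondPercolation (zdGraph 3) (criticalProbI 3)).real {ω : BondConfig (Site 3) |
        (∃ x : Site 3, ∀ i : Fin 3,
            (∃ u : Site 3, u i = -(n : ℤ) ∧ ω ∈ openConnIn ↑(box 3 n) x u) ∧
              (∃ v : Site 3, v i = (n : ℤ) ∧ ω ∈ openConnIn ↑(box 3 n) x v)) ∧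
          (∀ x y : Site 3,
            (∃ u v : Site 3, ω ∈ openConnIn ↑(box 3 n) x u ∧ ω ∈ openConnIn ↑(box 3 n) x v ∧
                ∃ i, (n : ℤ) ≤ |u i - v i|) →
              (∃ u v : Site 3, ω ∈ openConnIn ↑(box 3 n) y u ∧ ω ∈ openConnIn ↑(box 3 n) y v ∧
                  ∃ i, (n : ℤ) ≤ |u i - v i|) →
                ω ∈ openConnIn ↑(box 3 n) x y)} ≤ 1 - δ :=
  real_goodBox_criticalProbI_le

end Summit.CriticalPhenomena.PercolationContinuityZ3.Theorems.RenormaliseFromLinearLRO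

end
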